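import Summits.AtomisticToContinuum.FouriersLaw.Theorems.JunctionLocalityNonBallisticLightConeAssemblyPart2d

/-!
# `NonBallistic` / light cone, assembly part 2e: the single-flip estimate of the synchronous coupling

Helper (`--supports stmt-AtomisticToContinuum-9127`) for stub `stub_lightConeWindow` (LC) of line `contact-current-forgetting`.
For ONE flipped momentum `i₀` and a far bond `(k, k+1)`, at a fixed `N`, this file bounds the pathwise mean square
`∫⁻ x, ∫⁻ ω, ((j_k(Φ_s(Θ_{i₀}x, Bω)) − j_k(Φ_s(x, Bω)))²) dW dμ_T` by
`(56(1+β)R³2^{−(k−i₀)})²·(195T² + 32) + 4√(C₄(b₁ + 2b₂))`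
given: the propagation bound of piece FS-A (hypothesis; landed as `chainFlow_momentumFlip_propagation`), the kinematic bound
of piece FS-B (hypothesis), an exceptional set `E` of `μ_T ⊗ W`-measure `≤ b₂` off which `∫₀ᵗ p_i² ≤ Λ` (piece FS-C), the
Gibbs tail `μ_T{H > KN} ≤ b₁` (piece FS-D1, landed), `∫ j_k⁴ dμ_T ≤ C₄` (piece FS-D2) and the light-cone condition
`2e·3(A R²)t ≤ k − i₀` for `R = √(4√(KN/lam) + 2tΛ) + 1`.  Pointwise: on the good event the deterministic core (part 2c)
gives `Δ² ≤ d·(p_{i₀}⁴/2 + (1+|p_k|+|p_{k+1}|)⁴/2)`, on the bad event `Δ² ≤ 2j̃² + 2j²`; then the terms of part 2d.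
-/

noncomputable section

namespace Summit.AtomisticToContinuum.FouriersLaw.Theorems.NonBallistic

open MeasureTheory ProbabilityTheory Set Filter Topology
open scoped NNReal ENNReal
open Literature.MathematicalPhysics.KineticTheory.HeatConduction
open Literature.Probability.Process
open Summit.AtomisticToContinuum.FouriersLaw.Theorems.SubdiffusiveBondHeat

namespace FSAssembly

variable {ω₂ lam β γ : ℝ} (hω : 0 < ω₂) (hl : 0 < lam) (hβ : 0 < β) (hγ : 0 < γ) {N : ℕ} {T : ℝ} (hT : 0 < T)

include hω hl hβ hγ hT in
/-- **The single-flip estimate.** See the module docstring. All pieces enter as hypotheses at the fixed `N`. -/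
theorem single_flip_estimate (i₀ k : Fin N) (hk : k.val + 1 < N) (hik : i₀.val < k.val)
    {A K Λ t b₁ b₂ C₄ : ℝ} (hA : 0 ≤ A) (ht : 0 ≤ t) (hb₁ : 0 ≤ b₁) (hb₂ : 0 ≤ b₂) (hC₄ : 0 ≤ C₄)
    (hprop : ∀ (i₀ : Fin N) (x : PhaseSpace N) (η : ℝ → Fin N → ℝ), Continuous η →
      ∀ (R t : ℝ), 1 ≤ R → 0 ≤ t →
      (∀ s ∈ Set.Icc 0 t, ∀ i : Fin N,
          |((pinnedChain ω₂ lam β γ).chainFlow N x η s).1 i| ≤ R ∧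
          |((pinnedChain ω₂ lam β γ).chainFlow N (momentumFlip i₀ x) η s).1 i| ≤ R) →
      ∀ k : Fin N, i₀.val < k.val → 2 * Real.exp 1 * (3 * (A * R ^ 2) * t) ≤ ((k.val - i₀.val : ℕ) : ℝ) →
        |((pinnedChain ω₂ lam β γ).chainFlow N (momentumFlip i₀ x) η t).1 k -
            ((pinnedChain ω₂ lam β γ).chainFlow N x η t).1 k| +
          |((pinnedChain ω₂ lam β γ).chainFlow N (momentumFlip i₀ x) η t).2 k -
            ((pinnedChain ω₂ lam β γ).chainFlow N x η t).2 k|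
            ≤ 2 * (2 * |x.2 i₀|) * (1 / 2) ^ (k.val - i₀.val))
    (hkin : ∀ (x : PhaseSpace N) (η : ℝ → Fin N → ℝ), Continuous η → ∀ t : ℝ, 0 ≤ t →
      ∀ s ∈ Set.Icc 0 t, ∀ i : Fin N,
        ((pinnedChain ω₂ lam β γ).chainFlow N x η s).1 i ^ 2 ≤
          2 * (x.1 i) ^ 2 + 2 * t * ∫ u in (0:ℝ)..t, (((pinnedChain ω₂ lam β γ).chainFlow N x η u).2 i) ^ 2)
    (E : Set (PhaseSpace N × WienerPair)) (hEm : MeasurableSet E)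
    (hEπ : (((pinnedChain ω₂ lam β γ).gibbsMeasure N T).prod wienerPair) E ≤ ENNReal.ofReal b₂)
    (hE : ∀ q ∉ E, ∀ i : Fin N,
      ∫ u in (0:ℝ)..t, (((pinnedChain ω₂ lam β γ).solMap N T T u q.1 (pairPath q.2)).2 i) ^ 2 ≤ Λ)
    (hB₁ : (pinnedChain ω₂ lam β γ).gibbsMeasure N T
        {x | K * N < (pinnedChain ω₂ lam β γ).hamiltonian N x} ≤ ENNReal.ofReal b₁)
    (hD2 : Integrable (fun x => (pinnedChain ω₂ lam β γ).bondCurrent N k x ^ 4)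
        ((pinnedChain ω₂ lam β γ).gibbsMeasure N T) ∧
      ∫ x, (pinnedChain ω₂ lam β γ).bondCurrent N k x ^ 4 ∂((pinnedChain ω₂ lam β γ).gibbsMeasure N T) ≤ C₄)
    {R : ℝ} (hR : R = Real.sqrt (4 * Real.sqrt (K * N / lam) + 2 * t * Λ) + 1)
    (hcone : 2 * Real.exp 1 * (3 * (A * R ^ 2) * t) ≤ ((k.val - i₀.val : ℕ) : ℝ))
    (s : ℝ≥0) (hs : (s : ℝ) ≤ t) :
    ∫⁻ x, ∫⁻ ω, ENNReal.ofReal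
        (((pinnedChain ω₂ lam β γ).bondCurrent N k
            ((pinnedChain ω₂ lam β γ).solMap N T T s (momentumFlip i₀ x) (pairPath ω)) -
          (pinnedChain ω₂ lam β γ).bondCurrent N k
            ((pinnedChain ω₂ lam β γ).solMap N T T s x (pairPath ω))) ^ 2)
        ∂wienerPair ∂((pinnedChain ω₂ lam β γ).gibbsMeasure N T) ≤
      ENNReal.ofReal ((56 * (1 + β) * R ^ 3 * (1 / 2) ^ (k.val - i₀.val)) ^ 2 * (195 * T ^ 2 + 32)) +
        ENNReal.ofReal (4 * Real.sqrt (C₄ * (b₁ + 2 * b₂))) := by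
  set P := pinnedChain ω₂ lam β γ with hP
  set μ := P.gibbsMeasure N T with hμ
  haveI hμP : IsProbabilityMeasure μ := pinnedChain_isProbabilityMeasure_gibbsMeasure hω hl.le hβ.le γ N hT
  have hN0 : 0 < N := by omega
  set k1 : Fin N := ⟨k.val + 1, hk⟩ with hk1
  set d : ℝ := (56 * (1 + β) * R ^ 3 * (1 / 2) ^ (k.val - i₀.val)) ^ 2 with hd
  have hd0 : 0 ≤ d := sq_nonneg _
  have hR1 : 1 ≤ R := by rw [hR]; linarith [Real.sqrt_nonneg (4 * Real.sqrt (K * N / lam) + 2 * t * Λ)]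
  -- measurability of the two flows at time s, jointly in (x, ω)
  have hzm : Measurable fun q : PhaseSpace N × WienerPair => P.solMap N T T s q.1 (pairPath q.2) :=
    pinnedChain_measurable_solMap_pairPath hω hl.le hβ.le hγ.le N T T s
  -- NB (cf. `pinnedChain_measurable_solMap_pairPath`): never elaborate `Measurable.comp` AGAINST an expected type
  -- mentioning `solMap` (the unifier unfolds the flow and times out) — build the term first, then `exact` it.
  set Θ : PhaseSpace N × WienerPair → PhaseSpace N × WienerPair := fun q => (momentumFlip i₀ q.1, q.2) with hΘ
  have hΘm : Measurable Θ := ((measurable_momentumFlip i₀).comp measurable_fst).prodMk measurable_snd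
  have hz'm : Measurable fun q : PhaseSpace N × WienerPair =>
      P.solMap N T T s (momentumFlip i₀ q.1) (pairPath q.2) := by
    have h := hzm.comp hΘm
    exact h
  have hjc : Continuous (P.bondCurrent N k) := pinnedChain_continuous_bondCurrent ω₂ lam β γ N k
  have hjm : Measurable (P.bondCurrent N k) := hjc.measurable
  -- the currents along the two flows, and the weight
  set J : PhaseSpace N × WienerPair → ℝ := fun q => P.bondCurrent N k (P.solMap N T T s q.1 (pairPath q.2)) with hJ
  set J' : PhaseSpace N × WienerPair → ℝ := fun q =>
    P.bondCurrent N k (P.solMap N T T s (momentumFlip i₀ q.1) (pairPath q.2)) with hJ'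
  have hJm : Measurable J := by
    have h := hjm.comp hzm
    exact h
  have hJ'm : Measurable J' := by
    have h := hjm.comp hz'm
    exact h
  set g₂ : PhaseSpace N → ℝ := fun z => (1 + |z.2 k| + |z.2 k1|) ^ 4 / 2 with hg₂
  have hg₂m : Measurable g₂ := by
    have h1 : Measurable fun z : PhaseSpace N => z.2 k := (measurable_pi_apply k).comp measurable_snd
    have h2 : Measurable fun z : PhaseSpace N => z.2 k1 := (measurable_pi_apply k1).comp measurable_snd
    exact (((measurable_const.add h1.abs).add h2.abs).pow_const 4).div_const 2
  set g₁ : PhaseSpace N → ℝ := fun x => (x.2 i₀) ^ 4 / 2 with hg₁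
  have hg₁m : Measurable g₁ := (((measurable_pi_apply i₀).comp measurable_snd).pow_const 4).div_const 2
  -- the bad event
  set B₁ : Set (PhaseSpace N) := {x | K * N < P.hamiltonian N x} with hB₁def
  have hB₁m : MeasurableSet B₁ :=
    measurableSet_lt measurable_const (pinnedChain_continuous_hamiltonian ω₂ lam β γ N).measurable
  set BAD : Set (PhaseSpace N × WienerPair) := (Prod.fst ⁻¹' B₁ ∪ E) ∪ Θ ⁻¹' E with hBAD
  have hBADm : MeasurableSet BAD := ((measurable_fst hB₁m).union hEm).union (hΘm hEm)
  -- the integrand and its two majorants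
  set F : PhaseSpace N × WienerPair → ℝ≥0∞ := fun q => ENNReal.ofReal ((J' q - J q) ^ 2) with hF
  set G₁ : PhaseSpace N × WienerPair → ℝ≥0∞ := fun q =>
    ENNReal.ofReal (d * g₁ q.1) + ENNReal.ofReal (d * g₂ (P.solMap N T T s q.1 (pairPath q.2))) with hG₁
  set G₂ : PhaseSpace N × WienerPair → ℝ≥0∞ := fun q =>
    2 * (BAD.indicator (fun _ => (1 : ℝ≥0∞)) q * ENNReal.ofReal (J' q ^ 2)) +
      2 * (BAD.indicator (fun _ => (1 : ℝ≥0∞)) q * ENNReal.ofReal (J q ^ 2)) with hG₂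
  have hFm : Measurable F := ENNReal.measurable_ofReal.comp ((hJ'm.sub hJm).pow_const 2)
  have hg₂zm : Measurable fun q : PhaseSpace N × WienerPair => g₂ (P.solMap N T T s q.1 (pairPath q.2)) := by
    have h := hg₂m.comp hzm
    exact h
  have hG₁m : Measurable G₁ :=
    (ENNReal.measurable_ofReal.comp (measurable_const.mul (hg₁m.comp measurable_fst))).add
      (ENNReal.measurable_ofReal.comp (measurable_const.mul hg₂zm))
  have hindm : Measurable (BAD.indicator fun _ => (1 : ℝ≥0∞)) := measurable_const.indicator hBADm
  have hG₂m : Measurable G₂ :=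
    (measurable_const.mul (hindm.mul (ENNReal.measurable_ofReal.comp (hJ'm.pow_const 2)))).add
      (measurable_const.mul (hindm.mul (ENNReal.measurable_ofReal.comp (hJm.pow_const 2))))
  ------------------------------------------------------------------
  -- Step 1: pointwise domination `F ≤ G₁ + G₂`
  ------------------------------------------------------------------
  have hdom : ∀ q, F q ≤ G₁ q + G₂ q := by
    rintro ⟨x, ω⟩
    by_cases hq : (x, ω) ∈ BAD
    · -- on the bad event: (a - b)² ≤ 2a² + 2b²
      have h1 : F (x, ω) ≤ G₂ (x, ω) := by
        simp only [hF, hG₂, Set.indicator_of_mem hq, one_mul]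
        have e : (J' (x, ω) - J (x, ω)) ^ 2 ≤ 2 * J' (x, ω) ^ 2 + 2 * J (x, ω) ^ 2 := by
          nlinarith [sq_nonneg (J' (x, ω) + J (x, ω))]
        calc ENNReal.ofReal ((J' (x, ω) - J (x, ω)) ^ 2)
            ≤ ENNReal.ofReal (2 * J' (x, ω) ^ 2 + 2 * J (x, ω) ^ 2) := ENNReal.ofReal_le_ofReal e
          _ = 2 * ENNReal.ofReal (J' (x, ω) ^ 2) + 2 * ENNReal.ofReal (J (x, ω) ^ 2) := by
              rw [ENNReal.ofReal_add (by positivity) (by positivity), ENNReal.ofReal_mul (by norm_num),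
                ENNReal.ofReal_mul (by norm_num), ENNReal.ofReal_ofNat]
      exact h1.trans le_add_self
    · -- on the good event: the cone bound of part 2c
      have hx₁ : P.hamiltonian N x ≤ K * N := by
        by_contra h
        exact hq (Or.inl (Or.inl (lt_of_not_ge h)))
      have hxE : (x, ω) ∉ E := fun h => hq (Or.inl (Or.inr h))
      have hx'E : (momentumFlip i₀ x, ω) ∉ E := fun h => hq (Or.inr (show Θ (x, ω) ∈ E from h))
      set η : ℝ → Fin N → ℝ := P.pairNoise N T T (pairPath ω) with hη
      have hηc : Continuous η := P.continuous_pairNoise N T T (pairPath ω)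
      have hsol : ∀ (y : PhaseSpace N) (u : ℝ), P.solMap N T T u y (pairPath ω) = P.chainFlow N y η u :=
        fun _ _ => rfl
      -- positions of a flow started at y with H(y) ≤ KN and (y, ω) ∉ E
      have hposy : ∀ y : PhaseSpace N, P.hamiltonian N y ≤ K * N → (y, ω) ∉ E →
          ∀ r ∈ Icc 0 t, ∀ i : Fin N, |(P.chainFlow N y η r).1 i| ≤ R := by
        intro y hHy hyE
        have hz0 : ∀ i, (P.chainFlow N y η 0).1 i = y.1 i := by
          intro i
          rw [hP, pinnedChain_chainFlow_of_nonpos ω₂ lam β γ N y hηc le_rfl]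
          simp
        have hkin' : ∀ r ∈ Icc 0 t, ∀ i : Fin N, (P.chainFlow N y η r).1 i ^ 2 ≤
            2 * (P.chainFlow N y η 0).1 i ^ 2 + 2 * t * ∫ u in (0:ℝ)..t, ((P.chainFlow N y η u).2 i) ^ 2 := by
          intro r hr i
          rw [hz0 i]
          exact hkin y η hηc t ht r hr i
        have hmom : ∀ i : Fin N, ∫ u in (0:ℝ)..t, ((P.chainFlow N y η u).2 i) ^ 2 ≤ Λ := fun i => hE (y, ω) hyE i
        have := positions_le_of_kinematic (ω₂ := ω₂) (γ := γ) hω.le hl hβ.le y (fun u => P.chainFlow N y η u)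
          (E := K * N) (Λ := Λ) ht hz0 hkin' hHy hmom
        rw [hR]
        exact this
      have hpos : ∀ r ∈ Set.Icc 0 t, ∀ i : Fin N,
          |(P.chainFlow N x η r).1 i| ≤ R ∧ |(P.chainFlow N (momentumFlip i₀ x) η r).1 i| ≤ R :=
        fun r hr i => ⟨hposy x hx₁ hxE r hr i,
          hposy (momentumFlip i₀ x) (by rw [P.hamiltonian_momentumFlip]; exact hx₁) hx'E r hr i⟩
      have hsI : (s : ℝ) ∈ Set.Icc 0 t := ⟨s.2, hs⟩
      have main := sq_bondCurrent_diff_le_of_cone (ω₂ := ω₂) (lam := lam) (γ := γ) hβ.le hA hprop i₀ k hk hik x η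
        hηc hR1 hpos hcone hsI
      -- rewrite the estimate as `d * (p_{i₀}² (1+|p_k|+|p_{k+1}|)²)` and dominate by `d g₁ + d g₂`
      have hW : (7 * (1 + β) * R ^ 3 * (8 * |x.2 i₀|) * (1 / 2) ^ (k.val - i₀.val)) ^ 2 *
            (1 + |(P.chainFlow N x η s).2 k| + |(P.chainFlow N x η s).2 ⟨k.val + 1, hk⟩|) ^ 2 ≤
          d * g₁ x + d * g₂ (P.chainFlow N x η s) := by
        simp only [hd, hg₁, hg₂]
        have hp2 : |x.2 i₀| ^ 2 = (x.2 i₀) ^ 2 := sq_abs _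
        set S := 1 + |(P.chainFlow N x η s).2 k| + |(P.chainFlow N x η s).2 ⟨k.val + 1, hk⟩| with hS
        have hS0 : 0 ≤ S := by positivity
        set c := 56 * (1 + β) * R ^ 3 * (1 / 2) ^ (k.val - i₀.val) with hc
        have e1 : (7 * (1 + β) * R ^ 3 * (8 * |x.2 i₀|) * (1 / 2) ^ (k.val - i₀.val)) ^ 2 * S ^ 2 =
            c ^ 2 * ((x.2 i₀) ^ 2 * S ^ 2) := by
          rw [← hp2]; simp only [hc]; ring
        rw [e1]
        have hyoung : (x.2 i₀) ^ 2 * S ^ 2 ≤ (x.2 i₀) ^ 4 / 2 + S ^ 4 / 2 := by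
          nlinarith [sq_nonneg ((x.2 i₀) ^ 2 - S ^ 2)]
        have := mul_le_mul_of_nonneg_left hyoung (sq_nonneg c)
        simpa only [hS, mul_add] using this
      have hreal : (J' (x, ω) - J (x, ω)) ^ 2 ≤ d * g₁ x + d * g₂ (P.solMap N T T s x (pairPath ω)) := by
        simp only [hJ, hJ']
        rw [hsol x s, hsol (momentumFlip i₀ x) s]
        exact main.trans hW
      have h1 : F (x, ω) ≤ G₁ (x, ω) := by
        simp only [hF, hG₁]
        calc ENNReal.ofReal ((J' (x, ω) - J (x, ω)) ^ 2)
            ≤ ENNReal.ofReal (d * g₁ x + d * g₂ (P.solMap N T T s x (pairPath ω))) := ENNReal.ofReal_le_ofReal hreal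
          _ ≤ ENNReal.ofReal (d * g₁ x) + ENNReal.ofReal (d * g₂ (P.solMap N T T s x (pairPath ω))) :=
              ENNReal.ofReal_add_le
      exact h1.trans le_self_add
  ------------------------------------------------------------------
  -- Step 2: integrate; pass to the product measure
  ------------------------------------------------------------------
  set π : Measure (PhaseSpace N × WienerPair) := μ.prod wienerPair with hπ
  haveI hπP : IsProbabilityMeasure π := by rw [hπ]; infer_instance
  have hiter : ∀ {G : PhaseSpace N × WienerPair → ℝ≥0∞}, Measurable G →
      ∫⁻ x, ∫⁻ ω, G (x, ω) ∂wienerPair ∂μ = ∫⁻ q, G q ∂π := by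
    intro G hG
    exact (lintegral_prod G hG.aemeasurable).symm
  have hsplit : ∫⁻ x, ∫⁻ ω, F (x, ω) ∂wienerPair ∂μ ≤ ∫⁻ q, G₁ q ∂π + ∫⁻ q, G₂ q ∂π := by
    calc ∫⁻ x, ∫⁻ ω, F (x, ω) ∂wienerPair ∂μ = ∫⁻ q, F q ∂π := hiter hFm
      _ ≤ ∫⁻ q, (G₁ q + G₂ q) ∂π := lintegral_mono hdom
      _ = ∫⁻ q, G₁ q ∂π + ∫⁻ q, G₂ q ∂π := lintegral_add_left hG₁m _
  ------------------------------------------------------------------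
  -- Step 3: the two terms (lemmas above)
  ------------------------------------------------------------------
  have hT1 : ∫⁻ q, G₁ q ∂π ≤ ENNReal.ofReal (d * (195 * T ^ 2 + 32)) :=
    lintegral_weight_le hω hl hβ hγ hT hN0 i₀ k k1 hd0 s
  have hπBAD : π BAD ≤ ENNReal.ofReal (b₁ + 2 * b₂) := measure_bad_le P N T i₀ hB₁m hEm hb₁ hb₂ hB₁ hEπ
  have h44 := lintegral_current_four_le hω hl hβ hγ hT hN0 i₀ k hD2 s
  have hT2 : ∫⁻ q, G₂ q ∂π ≤ ENNReal.ofReal (4 * Real.sqrt (C₄ * (b₁ + 2 * b₂))) := by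
    have hm1 : Measurable fun q => BAD.indicator (fun _ => (1 : ℝ≥0∞)) q * ENNReal.ofReal (J' q ^ 2) :=
      hindm.mul (ENNReal.measurable_ofReal.comp (hJ'm.pow_const 2))
    have hm2 : Measurable fun q => BAD.indicator (fun _ => (1 : ℝ≥0∞)) q * ENNReal.ofReal (J q ^ 2) :=
      hindm.mul (ENNReal.measurable_ofReal.comp (hJm.pow_const 2))
    have hb : 0 ≤ b₁ + 2 * b₂ := by positivity
    have hH1 := lintegral_indicator_sq_le_sqrt π hJ'm hBADm hC₄ hb h44.2 hπBAD
    have hH2 := lintegral_indicator_sq_le_sqrt π hJm hBADm hC₄ hb h44.1 hπBAD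
    have hm1' : Measurable fun q => 2 * (BAD.indicator (fun _ => (1 : ℝ≥0∞)) q * ENNReal.ofReal (J' q ^ 2)) :=
      hm1.const_mul 2
    calc ∫⁻ q, G₂ q ∂π = 2 * ∫⁻ q, BAD.indicator (fun _ => (1 : ℝ≥0∞)) q * ENNReal.ofReal (J' q ^ 2) ∂π +
          2 * ∫⁻ q, BAD.indicator (fun _ => (1 : ℝ≥0∞)) q * ENNReal.ofReal (J q ^ 2) ∂π := by
          simp only [hG₂]
          rw [lintegral_add_left hm1', lintegral_const_mul 2 hm1, lintegral_const_mul 2 hm2]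
      _ ≤ 2 * ENNReal.ofReal (Real.sqrt (C₄ * (b₁ + 2 * b₂))) + 2 * ENNReal.ofReal (Real.sqrt (C₄ * (b₁ + 2 * b₂))) :=
          add_le_add (mul_le_mul' le_rfl hH1) (mul_le_mul' le_rfl hH2)
      _ = ENNReal.ofReal (4 * Real.sqrt (C₄ * (b₁ + 2 * b₂))) := by
          rw [← two_mul, ← mul_assoc, ← ENNReal.ofReal_ofNat 2, ← ENNReal.ofReal_mul (by norm_num),
            ← ENNReal.ofReal_mul (by norm_num)]
          congr 1; ring
  -- conclusion
  calc ∫⁻ x, ∫⁻ ω, F (x, ω) ∂wienerPair ∂μ ≤ ∫⁻ q, G₁ q ∂π + ∫⁻ q, G₂ q ∂π := hsplit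
    _ ≤ ENNReal.ofReal (d * (195 * T ^ 2 + 32)) + ENNReal.ofReal (4 * Real.sqrt (C₄ * (b₁ + 2 * b₂))) :=
        add_le_add hT1 hT2

end FSAssembly

end Summit.AtomisticToContinuum.FouriersLaw.Theorems.NonBallistic

end
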